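import Summits.ResolutionOfSingularities.ResolutionOfSingularities.Theorems.WeightedInvariantKWildHomDrop
import Summits.ResolutionOfSingularities.ResolutionOfSingularities.Theorems.WeightedInvariantIota3SigmaDescentDense
import Summits.ResolutionOfSingularities.ResolutionOfSingularities.Theorems.WeightedInvariantWeightedConstructionExtReesBaseChange
import Summits.ResolutionOfSingularities.ResolutionOfSingularities.Theorems.WeightedInvariantWeightedConstructionWeightedChartBasicOpen
import Literature.AlgebraicGeometry.Resolution.CobordantBlowupExtReesBridge
import Literature.AlgebraicGeometry.Resolution.CobordantBlowupRegular
import Mathlib.RingTheory.Flat.FaithfullyFlat.Algebra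
import Mathlib.RingTheory.Flat.Localization
import Literature.AlgebraicGeometry.Resolution.AdicNoetherian
import HarnessLib

/-!
# (K-red): the (drop) conjunct at `t`-homogeneous successors REDUCES TO THE COMPLETE CASE — `WeightedDropHom` descends along dense
# flat local maps `S → Ŝ` (completions), for invariants `ι` compatible with that class

Route `ResolutionOfSingularities/WeightedInvariant`, door crux `HypersurfaceCentreConstruction` (stmt-ResolutionOfSingularities-19897), P3 rung;
ORDER (o60) of res-L1-w43-plan-1 (16:25:32Z) to res-type-060, first deliverable (K-red).  [OURS · L1 W4.3 · helper, counted 0]  AI proof, weaker than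
expert review; bookkeeping on OUR clause vocabulary (`WeightedDropHom`, p540275), nothing here is a statement of the manuscript under review.
THE CLASS (p547970): `S → Ŝ` an algebra of Noetherian local rings, `Module.Flat S Ŝ`, `𝔪_S·Ŝ = 𝔪_Ŝ`, DENSE (`∀ n y, ∃ x, y − x·1 ∈ 𝔪_Ŝⁿ`), e.g.
`Ŝ = AdicCompletion 𝔪 S`; `IotaDenseCompatible ι` := `ι Ŝ (f·1) = ι S f` along every such map (§0; discharged for `iotaOrd` (057's (o39)) and
`Iota3.iotaSigma` (p547970); for `iotaFlatT` it is the dense-class row of (c11), to be supplied by its letters' owners).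
§1 base change of `B = S[t⁻¹, uᵢ t^{wᵢ}]` along the class via the tree's `ψ : B → B̂` (`stub_extReesAlgebra_baseChange`, `B̂ ≅ Ŝ ⊗_S B`): FAITHFULLY
FLAT (`faithfullyFlat_psi`), PURE (`comap_map_psi`), DENSE modulo `𝔪_Ŝⁿ·B̂` (`exists_sub_psi_mem`).  §2 for a prime `𝔫 ⊇ 𝔪B`: `𝔫̂ := 𝔫·B̂` is PRIME with
`𝔫̂ ∩ B = 𝔫`, `t`-homogeneous when `𝔫` is, and `B_𝔫 → B̂_𝔫̂` is again in the class (`map_maximalIdeal_loc`, `dense_loc`; flat by Mathlib).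
§3 **`weightedDropHom_of_dense`**: `IotaDenseCompatible ι →` class facts `→ WeightedDropHom ι Ŝ f̂ 𝔪̂ û w → WeightedDropHom ι S f 𝔪 u w` (point centre
`P = 𝔪`; for a smaller centre prime localise `S` first) and `weightedDropHom_of_adicCompletion`: the wild successor drop becomes a statement in
`K⟦u₁,…,u_d⟧` (Cohen), where the K1 certificate (p542872) and the idea-1/idea-2 census live.
[cite: Matsumura1987, Thm. 7.5, Thm. 8.14] [cite: Wlodarczyk2022, Def. 5.1.1 (cobordant blow-up commutes with flat base change)] -/

noncomputable section

set_option linter.dupNamespace false -- mandated namespace of this single-conjunct summit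

open IsLocalRing Literature.AlgebraicGeometry.Resolution
open Summit.ResolutionOfSingularities.ResolutionOfSingularities.Theorems
open scoped TensorProduct LaurentPolynomial

namespace Summit.ResolutionOfSingularities.ResolutionOfSingularities.Cruxes.HypersurfaceCentreConstruction.LocalEngine
/-! ## §0 Invariants compatible with dense flat local maps -/
/-- [OURS · (o60)] **`ι` is compatible with DENSE FLAT LOCAL MAPS** (flat algebras `S → S'` of Noetherian local rings with `𝔪_S·S' = 𝔪_{S'}` and
`S' = S + 𝔪_{S'}ⁿ` for all `n` — completions): `ι S' (f·1) = ι S f`.  The dense-class row of (c11); a predicate of the line, not a cited statement. -/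
def IotaDenseCompatible (ι : (R : Type) → [CommRing R] → R → Ordinal.{0}) : Prop :=
  ∀ (S S' : Type) [CommRing S] [CommRing S'] [IsLocalRing S] [IsLocalRing S'] [IsNoetherianRing S] [IsNoetherianRing S']
    [Algebra S S'] [Module.Flat S S'],
    (maximalIdeal S).map (algebraMap S S') = maximalIdeal S' →
    (∀ (n : ℕ) (y : S'), ∃ x : S, y - algebraMap S S' x ∈ maximalIdeal S' ^ n) →
    ∀ f : S, ι S' (algebraMap S S' f) = ι S f

/-- `ν = iotaOrd` is compatible with dense flat local maps (057's `adicOrder_algebraMap_eq_of_flat`). [OURS · L1 W4.3] -/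
theorem iotaDenseCompatible_iotaOrd : IotaDenseCompatible iotaOrd := by
  intro S S' _ _ _ _ _ _ _ _ hm _ f
  rw [iotaOrd_eq_ordOfENat_adicOrder, iotaOrd_eq_ordOfENat_adicOrder, Iota3.adicOrder_algebraMap_eq_of_flat hm]

/-- `σ = Iota3.iotaSigma` is compatible with dense flat local maps (p547970 `iotaSigma_algebraMap_eq_of_dense`). [OURS · L1 W4.3] -/
theorem iotaDenseCompatible_iotaSigma : IotaDenseCompatible Iota3.iotaSigma := by
  intro S S' _ _ _ _ _ _ _ _ hm hdense f
  exact Iota3.iotaSigma_algebraMap_eq_of_dense hm hdense f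

namespace KRed
/-! ## §1 Base change of the cobordant algebra along a dense flat local map -/
section BaseChange

variable {S Ŝ : Type} [CommRing S] [CommRing Ŝ] [Algebra S Ŝ] {n : ℕ} (u : Fin n → S) (w : Fin n → ℕ)
  (ψ : cobordantAlgebra' u w →+* cobordantAlgebra' (fun i => algebraMap S Ŝ (u i)) w)
  (hψ : ∀ x : cobordantAlgebra' u w, ((ψ x : cobordantAlgebra' (fun i => algebraMap S Ŝ (u i)) w) : Ŝ[T;T⁻¹]) =
    AddMonoidAlgebra.mapRingHom ℤ (algebraMap S Ŝ) (x : S[T;T⁻¹]))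

/-- The weighted filtrations correspond: `J_m(û) = J_m(u)·Ŝ`. [folklore] -/
theorem weightedMonomialIdeal_algebraMap_eq (m : ℕ) :
    weightedMonomialIdeal (fun i => algebraMap S Ŝ (u i)) w m = (weightedMonomialIdeal u w m).map (algebraMap S Ŝ) :=
  (weightedMonomialIdeal_map (algebraMap S Ŝ) u w m).symm

include hψ

/-- `ψ` lies over `S → Ŝ`. [folklore] -/
theorem psi_algebraMap (s : S) :
    ψ (algebraMap S (cobordantAlgebra' u w) s) = algebraMap Ŝ _ (algebraMap S Ŝ s) :=
  strictTransformLoc_map_algebraMap _ _ ψ hψ s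

/-- `ψ` is compatible with the `S`-algebra structures. [folklore] -/
theorem psi_comp_algebraMap :
    ψ.comp (algebraMap S (cobordantAlgebra' u w)) = algebraMap S (cobordantAlgebra' (fun i => algebraMap S Ŝ (u i)) w) := by
  ext s
  rw [RingHom.comp_apply, psi_algebraMap u w ψ hψ, ← IsScalarTower.algebraMap_apply]

/-- `ψ (t⁻¹) = t⁻¹`. [folklore] -/
theorem psi_cobordantT' : ψ (cobordantT' u w) = cobordantT' (fun i => algebraMap S Ŝ (u i)) w :=
  strictTransformLoc_map_tInv _ _ ψ hψ

/-- `ψ` preserves `t`-degrees: it maps the degree-`i` piece into the degree-`i` piece. [folklore] -/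
theorem psi_mem_tGrading {i : ℤ} {x : cobordantAlgebra' u w} (hx : x ∈ KWildHom.tGrading u w i) :
    ψ x ∈ KWildHom.tGrading (fun i => algebraMap S Ŝ (u i)) w i := by
  rw [KWildHom.mem_tPiece_iff, AddMonoidAlgebra.mem_grade_iff] at hx ⊢
  rw [hψ]
  intro m hm
  refine hx ?_
  rw [Finsupp.mem_support_iff] at hm ⊢
  intro h0
  apply hm
  rw [AddMonoidAlgebra.coeff_mapRingHom, h0, map_zero]

variable [IsLocalRing Ŝ] [Module.Flat S Ŝ]

/-- **DENSITY of `ψ`**: if `Ŝ = S + 𝔪_Ŝᴺ` then every element of `B̂` is `ψ x + (element of 𝔪_Ŝᴺ·B̂)`. [folklore] -/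
theorem exists_sub_psi_mem (hdense : ∀ (N : ℕ) (y : Ŝ), ∃ x : S, y - algebraMap S Ŝ x ∈ maximalIdeal Ŝ ^ N) (N : ℕ)
    (y : cobordantAlgebra' (fun i => algebraMap S Ŝ (u i)) w) :
    ∃ x : cobordantAlgebra' u w, y - ψ x ∈ (maximalIdeal Ŝ ^ N).map (algebraMap Ŝ (cobordantAlgebra' (fun i => algebraMap S Ŝ (u i)) w)) := by
  obtain ⟨e, he⟩ := extReesBC_exists_algEquiv (weightedMonomialIdeal u w) (weightedMonomialIdeal (fun i => algebraMap S Ŝ (u i)) w) ψ hψ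
    (weightedMonomialIdeal_algebraMap_eq u w)
  set M := (maximalIdeal Ŝ ^ N).map (algebraMap Ŝ (cobordantAlgebra' (fun i => algebraMap S Ŝ (u i)) w)) with hM
  suffices h : ∀ z : Ŝ ⊗[S] cobordantAlgebra' u w, ∃ x : cobordantAlgebra' u w, e z - ψ x ∈ M by
    obtain ⟨x, hx⟩ := h (e.symm y)
    exact ⟨x, by rwa [AlgEquiv.apply_symm_apply] at hx⟩
  intro z
  induction z using TensorProduct.induction_on with
  | zero => exact ⟨0, by rw [map_zero, map_zero, sub_zero]; exact M.zero_mem⟩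
  | tmul a x =>
    obtain ⟨r, hr⟩ := hdense N a
    refine ⟨algebraMap S _ r * x, ?_⟩
    rw [he, map_mul, psi_algebraMap u w ψ hψ r, ← sub_mul, ← map_sub]
    exact M.mul_mem_right _ (Ideal.mem_map_of_mem _ hr)
  | add z₁ z₂ h₁ h₂ =>
    obtain ⟨x₁, hx₁⟩ := h₁
    obtain ⟨x₂, hx₂⟩ := h₂
    refine ⟨x₁ + x₂, ?_⟩
    have : e (z₁ + z₂) - ψ (x₁ + x₂) = (e z₁ - ψ x₁) + (e z₂ - ψ x₂) := by rw [map_add, map_add]; ring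
    rw [this]
    exact M.add_mem hx₁ hx₂

variable [IsLocalRing S] (hm : (maximalIdeal S).map (algebraMap S Ŝ) = maximalIdeal Ŝ)

include hm

/-- **`B̂ = B ⊗_S Ŝ` is FAITHFULLY FLAT over `B`** (along `ψ`): `Ŝ` is faithfully flat over the local `S`, and faithful flatness base-changes
(`extReesBC_exists_algEquiv` identifies `B̂` with `Ŝ ⊗_S B`). [cite: Matsumura1987, Thm. 7.5] -/
theorem faithfullyFlat_psi : letI := ψ.toAlgebra; Module.FaithfullyFlat (cobordantAlgebra' u w) (cobordantAlgebra' (fun i => algebraMap S Ŝ (u i)) w) := by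
  letI := ψ.toAlgebra
  haveI := Iota3.isLocalHom_of_map_maximalIdeal_eq hm
  haveI : Module.FaithfullyFlat S Ŝ := Module.FaithfullyFlat.of_flat_of_isLocalHom
  haveI : IsScalarTower S (cobordantAlgebra' u w) (cobordantAlgebra' (fun i => algebraMap S Ŝ (u i)) w) :=
    IsScalarTower.of_algebraMap_eq fun s => by
      rw [RingHom.algebraMap_toAlgebra, psi_algebraMap u w ψ hψ s, ← IsScalarTower.algebraMap_apply]
  obtain ⟨e, he⟩ := extReesBC_exists_algEquiv (weightedMonomialIdeal u w) (weightedMonomialIdeal (fun i => algebraMap S Ŝ (u i)) w) ψ hψ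
    (weightedMonomialIdeal_algebraMap_eq u w)
  let Φ : cobordantAlgebra' u w ⊗[S] Ŝ →ₐ[cobordantAlgebra' u w] cobordantAlgebra' (fun i => algebraMap S Ŝ (u i)) w :=
    Algebra.TensorProduct.lift (Algebra.ofId _ _) (IsScalarTower.toAlgHom S Ŝ _) fun _ _ => Commute.all _ _
  have hΦ : ∀ (x : cobordantAlgebra' u w) (a : Ŝ), Φ (x ⊗ₜ[S] a) = ψ x * algebraMap Ŝ _ a := fun x a => by
    rw [Algebra.TensorProduct.lift_tmul]
    rfl
  have hΦe : ∀ z, Φ z = e (TensorProduct.comm S _ _ z) := fun z => by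
    induction z using TensorProduct.induction_on with
    | zero => simp
    | tmul x a => rw [hΦ, TensorProduct.comm_tmul, he, mul_comm]
    | add x y hx hy => rw [map_add, hx, hy, map_add, map_add]
  have hbij : Function.Bijective Φ := by
    have : (Φ : _ → _) = e ∘ TensorProduct.comm S _ _ := funext hΦe
    rw [this]
    exact e.bijective.comp (TensorProduct.comm S _ _).bijective
  exact Module.FaithfullyFlat.of_linearEquiv (R := cobordantAlgebra' u w) (M := cobordantAlgebra' u w ⊗[S] Ŝ)
    (AlgEquiv.ofBijective Φ hbij).toLinearEquiv.symm

/-- **PURITY**: `(I·B̂) ∩ B = I` for every ideal `I` of `B`. [cite: Matsumura1987, Thm. 7.5] -/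
theorem comap_map_psi (I : Ideal (cobordantAlgebra' u w)) : (I.map ψ).comap ψ = I := by
  letI := ψ.toAlgebra
  haveI := faithfullyFlat_psi u w ψ hψ hm
  exact Ideal.comap_map_eq_self_of_faithfullyFlat I

end BaseChange
/-! ## §2 Primes over `𝔪`: `𝔫 ↦ 𝔫̂ = 𝔫·B̂` -/
/-- Fractions with numerators congruent modulo `Pᴺ` (after cross-multiplication) differ by an element of `𝔪_{R_P}ᴺ`. [folklore] -/
theorem mk'_sub_mk'_mem_pow {R L : Type*} [CommRing R] [CommRing L] [Algebra R L] (P : Ideal R) [P.IsPrime]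
    [IsLocalization.AtPrime L P] [IsLocalRing L] (z x : R) (s r : P.primeCompl) {N : ℕ} (h : z * r - x * s ∈ P ^ N) :
    IsLocalization.mk' L z s - IsLocalization.mk' L x r ∈ maximalIdeal L ^ N := by
  rw [← IsLocalization.mk'_sub, IsLocalization.mk'_eq_mul_mk'_one]
  refine Ideal.mul_mem_right _ _ ?_
  have := Ideal.mem_map_of_mem (algebraMap R L) h
  rwa [Ideal.map_pow, IsLocalization.AtPrime.map_eq_maximalIdeal P L] at this

section Primes

variable {S Ŝ : Type} [CommRing S] [CommRing Ŝ] [Algebra S Ŝ] [IsLocalRing S] [IsLocalRing Ŝ] [Module.Flat S Ŝ] {n : ℕ}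
  (u : Fin n → S) (w : Fin n → ℕ)
  (ψ : cobordantAlgebra' u w →+* cobordantAlgebra' (fun i => algebraMap S Ŝ (u i)) w)
  (hψ : ∀ x : cobordantAlgebra' u w, ((ψ x : cobordantAlgebra' (fun i => algebraMap S Ŝ (u i)) w) : Ŝ[T;T⁻¹]) =
    AddMonoidAlgebra.mapRingHom ℤ (algebraMap S Ŝ) (x : S[T;T⁻¹]))
  (hm : (maximalIdeal S).map (algebraMap S Ŝ) = maximalIdeal Ŝ)
  (hdense : ∀ (N : ℕ) (y : Ŝ), ∃ x : S, y - algebraMap S Ŝ x ∈ maximalIdeal Ŝ ^ N)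

include hψ hm

omit [Module.Flat S Ŝ] in
/-- `𝔪_Ŝ·B̂ = (𝔪_S·B)·B̂`. [folklore] -/
theorem map_maximalIdeal_hat_eq :
    (maximalIdeal Ŝ).map (algebraMap Ŝ (cobordantAlgebra' (fun i => algebraMap S Ŝ (u i)) w)) =
      ((maximalIdeal S).map (algebraMap S (cobordantAlgebra' u w))).map ψ := by
  rw [← hm, Ideal.map_map, Ideal.map_map, psi_comp_algebraMap u w ψ hψ,
    IsScalarTower.algebraMap_eq S Ŝ (cobordantAlgebra' (fun i => algebraMap S Ŝ (u i)) w)]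

omit [Module.Flat S Ŝ] in
/-- `𝔪_Ŝᴺ·B̂ ⊆ 𝔫̂ᴺ` for `𝔫 ⊇ 𝔪_S·B`. [folklore] -/
theorem map_pow_maximalIdeal_hat_le {𝔫 : Ideal (cobordantAlgebra' u w)}
    (h𝔪 : (maximalIdeal S).map (algebraMap S (cobordantAlgebra' u w)) ≤ 𝔫) (N : ℕ) :
    (maximalIdeal Ŝ ^ N).map (algebraMap Ŝ (cobordantAlgebra' (fun i => algebraMap S Ŝ (u i)) w)) ≤ 𝔫.map ψ ^ N := by
  rw [Ideal.map_pow, map_maximalIdeal_hat_eq u w ψ hψ hm]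
  exact Ideal.pow_right_mono (Ideal.map_mono h𝔪) N

include hdense

/-- **Density modulo `𝔫̂ᴺ`**: every element of `B̂` is `ψ x` plus an element of `𝔫̂ᴺ`, for `𝔫 ⊇ 𝔪_S·B`. [folklore] -/
theorem exists_sub_psi_mem_pow {𝔫 : Ideal (cobordantAlgebra' u w)}
    (h𝔪 : (maximalIdeal S).map (algebraMap S (cobordantAlgebra' u w)) ≤ 𝔫) (N : ℕ)
    (y : cobordantAlgebra' (fun i => algebraMap S Ŝ (u i)) w) : ∃ x : cobordantAlgebra' u w, y - ψ x ∈ 𝔫.map ψ ^ N := by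
  obtain ⟨x, hx⟩ := exists_sub_psi_mem u w ψ hψ hdense N y
  exact ⟨x, map_pow_maximalIdeal_hat_le u w ψ hψ hm h𝔪 N hx⟩

/-- **`𝔫̂ = 𝔫·B̂` IS PRIME** for a prime `𝔫 ⊇ 𝔪_S·B` (density + purity: `B̂/𝔫̂ ≅ B/𝔫`). [folklore] -/
theorem isPrime_map_psi (𝔫 : Ideal (cobordantAlgebra' u w)) [𝔫.IsPrime]
    (h𝔪 : (maximalIdeal S).map (algebraMap S (cobordantAlgebra' u w)) ≤ 𝔫) : (𝔫.map ψ).IsPrime := by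
  have hcomap := comap_map_psi u w ψ hψ hm 𝔫
  refine Ideal.isPrime_iff.mpr ⟨fun htop => ?_, fun {x y} hxy => ?_⟩
  · have : 𝔫 = ⊤ := by rw [← hcomap, htop, Ideal.comap_top]
    exact ‹𝔫.IsPrime›.ne_top this
  · obtain ⟨b, hb⟩ := exists_sub_psi_mem_pow u w ψ hψ hm hdense h𝔪 1 x
    obtain ⟨c, hc⟩ := exists_sub_psi_mem_pow u w ψ hψ hm hdense h𝔪 1 y
    rw [pow_one] at hb hc
    have hbc : ψ (b * c) ∈ 𝔫.map ψ := by
      have : ψ (b * c) = x * y - (x - ψ b) * y - ψ b * (y - ψ c) := by rw [map_mul]; ring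
      rw [this]
      exact Ideal.sub_mem _ (Ideal.sub_mem _ hxy (Ideal.mul_mem_right _ _ hb)) (Ideal.mul_mem_left _ _ hc)
    rw [← Ideal.mem_comap, hcomap] at hbc
    rcases ‹𝔫.IsPrime›.mem_or_mem hbc with h | h
    · left
      have : x = (x - ψ b) + ψ b := by ring
      rw [this]
      exact Ideal.add_mem _ hb (Ideal.mem_map_of_mem ψ h)
    · right
      have : y = (y - ψ c) + ψ c := by ring
      rw [this]
      exact Ideal.add_mem _ hc (Ideal.mem_map_of_mem ψ h)

omit hm hdense [IsLocalRing S] [IsLocalRing Ŝ] [Module.Flat S Ŝ] in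
/-- **`𝔫̂` is `t`-homogeneous when `𝔫` is** (`ψ` preserves `t`-degrees). [folklore] -/
theorem isTHomogeneous_map_psi {𝔫 : Ideal (cobordantAlgebra' u w)} (h : IsTHomogeneous u w 𝔫) :
    IsTHomogeneous (fun i => algebraMap S Ŝ (u i)) w (𝔫.map ψ) := by
  unfold IsTHomogeneous at h ⊢
  refine le_antisymm (Ideal.span_le.mpr fun y hy => hy.1) ?_
  conv_lhs => rw [← h, Ideal.map_span]
  refine Ideal.span_mono ?_
  rintro _ ⟨x, ⟨hx𝔫, i, hxi⟩, rfl⟩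
  refine ⟨?_, i, psi_mem_tGrading u w ψ hψ hxi⟩
  have hx' : x ∈ 𝔫 := hx𝔫
  exact Ideal.mem_map_of_mem ψ hx'

omit hψ hm hdense [IsLocalRing S] [IsLocalRing Ŝ] [Module.Flat S Ŝ] in
/-- Along any `L : B_𝔫 → B̂_𝔫̂` over `ψ` (`𝔫̂ = 𝔫·B̂`; any localisation models), **`𝔪_{B_𝔫}` extends to `𝔪_{B̂_𝔫̂}`**. [folklore] -/
theorem map_maximalIdeal_loc (𝔫 : Ideal (cobordantAlgebra' u w)) [𝔫.IsPrime]
    (𝔫' : Ideal (cobordantAlgebra' (fun i => algebraMap S Ŝ (u i)) w)) [𝔫'.IsPrime] (h𝔫' : 𝔫' = 𝔫.map ψ)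
    {L₁ L₂ : Type*} [CommRing L₁] [CommRing L₂] [Algebra (cobordantAlgebra' u w) L₁]
    [Algebra (cobordantAlgebra' (fun i => algebraMap S Ŝ (u i)) w) L₂] [IsLocalization.AtPrime L₁ 𝔫] [IsLocalization.AtPrime L₂ 𝔫']
    [IsLocalRing L₁] [IsLocalRing L₂] (L : L₁ →+* L₂)
    (hL : ∀ x, L (algebraMap _ L₁ x) = algebraMap _ L₂ (ψ x)) :
    (maximalIdeal L₁).map L = maximalIdeal L₂ := by
  have hcomp : L.comp (algebraMap _ L₁) = (algebraMap _ L₂).comp ψ := RingHom.ext hL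
  rw [← IsLocalization.AtPrime.map_eq_maximalIdeal 𝔫 L₁, Ideal.map_map, hcomp, ← Ideal.map_map, ← h𝔫',
    IsLocalization.AtPrime.map_eq_maximalIdeal 𝔫' L₂]

/-- Along any `L : B_𝔫 → B̂_𝔫̂` over `ψ` (any localisation models), **`B_𝔫` is DENSE in `B̂_𝔫̂`**, for `𝔫 ⊇ 𝔪_S·B`. [folklore] -/
theorem dense_loc (𝔫 : Ideal (cobordantAlgebra' u w)) [𝔫.IsPrime]
    (h𝔪 : (maximalIdeal S).map (algebraMap S (cobordantAlgebra' u w)) ≤ 𝔫)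
    (𝔫' : Ideal (cobordantAlgebra' (fun i => algebraMap S Ŝ (u i)) w)) [𝔫'.IsPrime] (h𝔫' : 𝔫' = 𝔫.map ψ)
    {L₁ L₂ : Type*} [CommRing L₁] [CommRing L₂] [Algebra (cobordantAlgebra' u w) L₁]
    [Algebra (cobordantAlgebra' (fun i => algebraMap S Ŝ (u i)) w) L₂] [IsLocalization.AtPrime L₁ 𝔫] [IsLocalization.AtPrime L₂ 𝔫']
    [IsLocalRing L₁] [IsLocalRing L₂] (L : L₁ →+* L₂)
    (hL : ∀ x, L (algebraMap _ L₁ x) = algebraMap _ L₂ (ψ x)) (N : ℕ) (y : L₂) :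
    ∃ x : L₁, y - L x ∈ maximalIdeal L₂ ^ N := by
  rcases Nat.eq_zero_or_pos N with rfl | hN
  · exact ⟨0, by rw [pow_zero, Ideal.one_eq_top]; exact Submodule.mem_top⟩
  obtain ⟨⟨z, s⟩, hy⟩ := IsLocalization.mk'_surjective 𝔫'.primeCompl y
  dsimp only at hy
  obtain ⟨x, hx⟩ := exists_sub_psi_mem_pow u w ψ hψ hm hdense h𝔪 N z
  obtain ⟨r, hr⟩ := exists_sub_psi_mem_pow u w ψ hψ hm hdense h𝔪 N (s : cobordantAlgebra' (fun i => algebraMap S Ŝ (u i)) w)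
  have hpow : 𝔫.map ψ ^ N ≤ 𝔫' := by rw [h𝔫']; exact Ideal.pow_le_self hN.ne'
  have hr𝔫 : r ∉ 𝔫 := fun hr𝔫 => s.2 (by
    have : (s : cobordantAlgebra' (fun i => algebraMap S Ŝ (u i)) w) = ((s : _) - ψ r) + ψ r := by ring
    rw [this]
    exact 𝔫'.add_mem (hpow hr) (by rw [h𝔫']; exact Ideal.mem_map_of_mem ψ hr𝔫))
  have hψr : ψ r ∉ 𝔫' := fun h => hr𝔫 (by
    rw [h𝔫', ← Ideal.mem_comap, comap_map_psi u w ψ hψ hm] at h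
    exact h)
  replace hψr : ψ r ∈ 𝔫'.primeCompl := hψr
  replace hr𝔫 : r ∈ 𝔫.primeCompl := hr𝔫
  refine ⟨IsLocalization.mk' L₁ x ⟨r, hr𝔫⟩, ?_⟩
  have hLx : L (IsLocalization.mk' L₁ x ⟨r, hr𝔫⟩) = IsLocalization.mk' L₂ (ψ x) ⟨ψ r, hψr⟩ := by
    have h1 : L (IsLocalization.mk' L₁ x ⟨r, hr𝔫⟩) * algebraMap _ _ (ψ r) = algebraMap _ _ (ψ x) := by
      rw [← hL r, ← map_mul, ← hL x]
      congr 1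
      exact IsLocalization.mk'_spec L₁ x ⟨r, hr𝔫⟩
    exact IsLocalization.eq_mk'_iff_mul_eq.mpr h1
  rw [← hy, hLx]
  have hle : 𝔫.map ψ ^ N ≤ 𝔫' ^ N := by rw [h𝔫']
  refine mk'_sub_mk'_mem_pow 𝔫' z (ψ x) s ⟨ψ r, hψr⟩ ?_
  have : z * ψ r - ψ x * (s : cobordantAlgebra' (fun i => algebraMap S Ŝ (u i)) w) = (z - ψ x) * ψ r - ψ x * ((s : _) - ψ r) := by
    ring
  show z * ψ r - ψ x * (s : cobordantAlgebra' (fun i => algebraMap S Ŝ (u i)) w) ∈ 𝔫' ^ N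
  rw [this]
  exact hle (Ideal.sub_mem _ (Ideal.mul_mem_right _ _ hx) (Ideal.mul_mem_left _ _ hr))

end Primes
/-! ## §3 The reduction -/
section Reduction

variable {ι : (R : Type) → [CommRing R] → R → Ordinal.{0}}
  {S Ŝ : Type} [CommRing S] [CommRing Ŝ] [Algebra S Ŝ] [IsLocalRing S] [IsLocalRing Ŝ] [IsNoetherianRing S] [IsNoetherianRing Ŝ]
  [Module.Flat S Ŝ] {n : ℕ} (u : Fin n → S) (w : Fin n → ℕ)

/-- **(K-red) — `WeightedDropHom` DESCENDS ALONG DENSE FLAT LOCAL MAPS** (`S → Ŝ` flat, `𝔪_S·Ŝ = 𝔪_Ŝ`, dense; `ι` compatible with the class):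
the (drop) conjunct at `t`-homogeneous successors for `(Ŝ, f·1, 𝔪_Ŝ, û, w)` gives it for `(S, f, 𝔪_S, u, w)` — `𝔫 ↦ 𝔫̂ = 𝔫·B̂` is a `t`-homogeneous prime
with the same side conditions, `B_𝔫 → B̂_𝔫̂` is again in the class, so `ι` agrees, and `ι Ŝ (f·1) = ι S f`. [OURS · L1 W4.3 · (o60) (K-red)] -/
theorem weightedDropHom_of_dense (hι : IotaDenseCompatible ι)
    (hm : (maximalIdeal S).map (algebraMap S Ŝ) = maximalIdeal Ŝ)
    (hdense : ∀ (N : ℕ) (y : Ŝ), ∃ x : S, y - algebraMap S Ŝ x ∈ maximalIdeal Ŝ ^ N) (f : S)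
    (h : WeightedDropHom ι Ŝ (algebraMap S Ŝ f) (maximalIdeal Ŝ) (fun i => algebraMap S Ŝ (u i)) w) :
    WeightedDropHom ι S f (maximalIdeal S) u w := by
  intro 𝔫 _ hhom hT h𝔪 hv a g hfac hndvd hsing
  obtain ⟨ψ, hψ, -, -, hψv, -, -⟩ := stub_extReesAlgebra_baseChange (weightedMonomialIdeal u w)
    (weightedMonomialIdeal (fun i => algebraMap S Ŝ (u i)) w) (KRed.weightedMonomialIdeal_algebraMap_eq u w)
  haveI h𝔫' : (𝔫.map ψ).IsPrime := KRed.isPrime_map_psi u w ψ hψ hm hdense 𝔫 h𝔪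
  have hcomap : (𝔫.map ψ).comap ψ = 𝔫 := KRed.comap_map_psi u w ψ hψ hm 𝔫
  have hT' : cobordantT' (fun i => algebraMap S Ŝ (u i)) w ∈ 𝔫.map ψ := by
    rw [← KRed.psi_cobordantT' u w ψ hψ]
    exact Ideal.mem_map_of_mem ψ hT
  have h𝔪' : (maximalIdeal Ŝ).map (algebraMap Ŝ (cobordantAlgebra' (fun i => algebraMap S Ŝ (u i)) w)) ≤ 𝔫.map ψ := by
    rw [KRed.map_maximalIdeal_hat_eq u w ψ hψ hm]
    exact Ideal.map_mono h𝔪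
  have hv' : ¬ extReesAlgebra.vertexIdeal (weightedMonomialIdeal (fun i => algebraMap S Ŝ (u i)) w) ≤ 𝔫.map ψ := fun hle => hv (by
    have := Ideal.comap_mono (f := ψ) hle
    rwa [← hψv, KRed.comap_map_psi u w ψ hψ hm, hcomap] at this)
  have hfac' : algebraMap Ŝ (cobordantAlgebra' (fun i => algebraMap S Ŝ (u i)) w) (algebraMap S Ŝ f) =
      cobordantT' (fun i => algebraMap S Ŝ (u i)) w ^ a * ψ g := by
    rw [← KRed.psi_algebraMap u w ψ hψ f, hfac, map_mul, map_pow, KRed.psi_cobordantT' u w ψ hψ]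
  have hndvd' : ¬ cobordantT' (fun i => algebraMap S Ŝ (u i)) w ∣ ψ g := fun hdvd => hndvd (by
    rw [← Ideal.mem_span_singleton] at hdvd ⊢
    rw [← KRed.psi_cobordantT' u w ψ hψ, ← Set.image_singleton, ← Ideal.map_span] at hdvd
    rw [← KRed.comap_map_psi u w ψ hψ hm (Ideal.span {cobordantT' u w}), Ideal.mem_comap]
    exact hdvd)
  letI := ψ.toAlgebra
  haveI : (𝔫.map ψ).LiesOver 𝔫 := ⟨by rw [Ideal.under_def]; exact hcomap.symm⟩
  letI instA : Algebra (Localization.AtPrime 𝔫) (Localization.AtPrime (𝔫.map ψ)) :=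
    Localization.AtPrime.algebraOfLiesOver 𝔫 (𝔫.map ψ)
  haveI : Module.FaithfullyFlat (cobordantAlgebra' u w) (cobordantAlgebra' (fun i => algebraMap S Ŝ (u i)) w) :=
    KRed.faithfullyFlat_psi u w ψ hψ hm
  haveI instF : Module.Flat (Localization.AtPrime 𝔫) (Localization.AtPrime (𝔫.map ψ)) := inferInstance
  haveI : IsNoetherianRing (cobordantAlgebra' u w) := by
    show IsNoetherianRing (extReesAlgebra (weightedMonomialIdeal u w))
    rw [extReesAlgebra_weightedMonomialIdeal_eq_cobordantAlgebra u w]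
    exact cobordantAlgebra.isNoetherianRing u w
  haveI : IsNoetherianRing (cobordantAlgebra' (fun i => algebraMap S Ŝ (u i)) w) := by
    show IsNoetherianRing (extReesAlgebra (weightedMonomialIdeal (fun i => algebraMap S Ŝ (u i)) w))
    rw [extReesAlgebra_weightedMonomialIdeal_eq_cobordantAlgebra _ w]
    exact cobordantAlgebra.isNoetherianRing _ w
  haveI instN : IsNoetherianRing (Localization.AtPrime 𝔫) := IsLocalization.isNoetherianRing 𝔫.primeCompl _ inferInstance
  haveI instN' : IsNoetherianRing (Localization.AtPrime (𝔫.map ψ)) :=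
    IsLocalization.isNoetherianRing (𝔫.map ψ).primeCompl _ inferInstance
  have hL : ∀ x, algebraMap (Localization.AtPrime 𝔫) (Localization.AtPrime (𝔫.map ψ)) (algebraMap _ (Localization.AtPrime 𝔫) x) =
      algebraMap _ (Localization.AtPrime (𝔫.map ψ)) (ψ x) := fun x =>
    Localization.localRingHom_to_map 𝔫 (𝔫.map ψ) (algebraMap _ _) Ideal.LiesOver.over x
  have hmL := KRed.map_maximalIdeal_loc u w ψ 𝔫 (𝔫.map ψ) rfl (L₁ := Localization.AtPrime 𝔫)
    (L₂ := Localization.AtPrime (𝔫.map ψ)) (algebraMap _ _) hL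
  have hdL := KRed.dense_loc u w ψ hψ hm hdense 𝔫 h𝔪 (𝔫.map ψ) rfl (L₁ := Localization.AtPrime 𝔫)
    (L₂ := Localization.AtPrime (𝔫.map ψ)) (algebraMap _ _) hL
  have hsing' : algebraMap _ (Localization.AtPrime (𝔫.map ψ)) (ψ g) ∈ maximalIdeal (Localization.AtPrime (𝔫.map ψ)) ^ 2 := by
    rw [← hL g, ← hmL, ← Ideal.map_pow]
    exact Ideal.mem_map_of_mem _ hsing
  have key := h (𝔫.map ψ) (KRed.isTHomogeneous_map_psi u w ψ hψ hhom) hT' h𝔪' hv' a (ψ g) hfac' hndvd' hsing'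
  have hιS : ι Ŝ (algebraMap S Ŝ f) = ι S f := hι S Ŝ hm hdense f
  have hιL : ι (Localization.AtPrime (𝔫.map ψ)) (algebraMap _ (Localization.AtPrime (𝔫.map ψ)) (ψ g)) =
      ι (Localization.AtPrime 𝔫) (algebraMap _ (Localization.AtPrime 𝔫) g) := by
    have := hι (Localization.AtPrime 𝔫) (Localization.AtPrime (𝔫.map ψ)) hmL hdL (algebraMap _ (Localization.AtPrime 𝔫) g)
    rwa [hL g] at this
  rw [hιS, hιL] at key
  exact key

/-- **(K-red) for the `𝔪`-adic completion**: the (drop) conjunct at `t`-homogeneous successors for `(Ŝ, f, 𝔪̂, u, w)`, `Ŝ = AdicCompletion 𝔪 S`,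
implies it for `(S, f, 𝔪, u, w)`, for every `ι` compatible with dense flat local maps. [OURS · L1 W4.3 · (o60) (K-red)] -/
theorem weightedDropHom_of_adicCompletion {S : Type} [CommRing S] [IsLocalRing S] [IsNoetherianRing S] {n : ℕ} (u : Fin n → S)
    (w : Fin n → ℕ) (hι : IotaDenseCompatible ι) (f : S)
    (h : WeightedDropHom ι (AdicCompletion (maximalIdeal S) S) (algebraMap S _ f) (maximalIdeal _)
      (fun i => algebraMap S (AdicCompletion (maximalIdeal S) S) (u i)) w) :
    WeightedDropHom ι S f (maximalIdeal S) u w :=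
  haveI := isNoetherianRing_adicCompletion_maximalIdeal S
  weightedDropHom_of_dense u w hι (Iota3.map_maximalIdeal_adicCompletion S) (Iota3.adicCompletion_dense S) f h

end Reduction

end KRed

end Summit.ResolutionOfSingularities.ResolutionOfSingularities.Cruxes.HypersurfaceCentreConstruction.LocalEngine
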